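import Mathlib
import HarnessLib

/-!
# Ward ⇒ Möbius, part 6: from two-reflection invariance and parity to full `O(3)` invariance

Support file for item stmt-CriticalPhenomena-5357 (`WardToMoebius`, route `PrimaryAtInfinity`,
sub-problem `Ising3DConformalLimit`).

Let `T : (ℝ³)ⁿ → ℝ` be invariant under the diagonal action of every product of two reflections
`ρ_u ρ_{u'}` in planes through the origin (`ρ_u y = y − 2⟪y,u⟫u`, `u, u'` unit vectors) and under
the parity `x ↦ −x`. Then `T` is invariant under the diagonal action of every linear isometry
`R ∈ O(3)` (`apply_linearIsometryEquiv_eq`). Proof: by the Cartan–Dieudonné theorem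
(`LinearIsometryEquiv.reflections_generate_dim`) `R` and `−R` are products of reflections; the
determinant (`Submodule.det_reflection`) shows that one of the two products has even length,
and an even product is a product of pairs. In odd dimension parity is orientation reversing,
which is why it supplies the second component of `O(3)`.

References: É. Cartan–J. Dieudonné (Mathlib `LinearIsometryEquiv.reflections_generate`);
Di Francesco–Mathieu–Sénéchal, *Conformal Field Theory* (1997) §4.1. No definitions are
introduced.
-/

noncomputable section

open Set Function Module
open scoped RealInnerProductSpace

namespace Summit.CriticalPhenomena.Ising3DConformalLimit.WardToMoebius

/-! ### Reflections of `ℝ³` as linear isometries -/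

/-- Mathlib's reflection in `(ℝ ∙ v)ᗮ` is `y ↦ y − 2⟪y,u⟫u` with `u = v/‖v‖`, for `v ≠ 0`.
[folklore] -/
theorem reflection_orthogonal_apply_eq {v : EuclideanSpace ℝ (Fin 3)} (hv : v ≠ 0)
    (y : EuclideanSpace ℝ (Fin 3)) :
    (ℝ ∙ v)ᗮ.reflection y = y - (2 * ⟪y, ‖v‖⁻¹ • v⟫) • (‖v‖⁻¹ • v) := by
  have hvn : ‖v‖ ≠ 0 := norm_ne_zero_iff.2 hv
  rw [Submodule.reflection_orthogonal_apply, Submodule.reflection_singleton_apply, inner_smul_right,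
    smul_smul, real_inner_comm]
  simp only [RCLike.ofReal_real_eq_id, id_eq]
  rw [← Nat.cast_smul_eq_nsmul ℝ, smul_smul, Nat.cast_ofNat, neg_sub]
  congr 2
  field_simp

/-- The norm of `v/‖v‖` is `1` for `v ≠ 0`. [folklore] -/
theorem norm_inv_norm_smul {v : EuclideanSpace ℝ (Fin 3)} (hv : v ≠ 0) : ‖‖v‖⁻¹ • v‖ = 1 := by
  rw [norm_smul, norm_inv, norm_norm, inv_mul_cancel₀ (norm_ne_zero_iff.2 hv)]

/-- The reflection attached to `v = 0` is the identity. [folklore] -/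
theorem reflection_orthogonal_zero (y : EuclideanSpace ℝ (Fin 3)) :
    (ℝ ∙ (0 : EuclideanSpace ℝ (Fin 3)))ᗮ.reflection y = y := by
  apply Submodule.reflection_mem_subspace_eq_self
  rw [Submodule.span_zero_singleton, Submodule.bot_orthogonal_eq_top]
  exact Submodule.mem_top

/-- The determinant of a reflection of `ℝ³` in a plane through the origin is `−1`. [folklore] -/
theorem det_reflection_orthogonal {v : EuclideanSpace ℝ (Fin 3)} (hv : v ≠ 0) :
    LinearMap.det ((ℝ ∙ v)ᗮ.reflection.toLinearEquiv :
      EuclideanSpace ℝ (Fin 3) →ₗ[ℝ] EuclideanSpace ℝ (Fin 3)) = -1 := by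
  rw [Submodule.det_reflection, Submodule.orthogonal_orthogonal, finrank_span_singleton hv, pow_one]

/-- Multiplicativity of the determinant on the group of linear isometries. [folklore] -/
theorem det_mul_linearIsometryEquiv (A B : EuclideanSpace ℝ (Fin 3) ≃ₗᵢ[ℝ] EuclideanSpace ℝ (Fin 3)) :
    LinearMap.det ((A * B).toLinearEquiv : EuclideanSpace ℝ (Fin 3) →ₗ[ℝ] EuclideanSpace ℝ (Fin 3))
      = LinearMap.det (A.toLinearEquiv : EuclideanSpace ℝ (Fin 3) →ₗ[ℝ] EuclideanSpace ℝ (Fin 3))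
        * LinearMap.det (B.toLinearEquiv : EuclideanSpace ℝ (Fin 3) →ₗ[ℝ] EuclideanSpace ℝ (Fin 3)) := by
  rw [← LinearMap.det_comp]
  congr 1

/-- The determinant of `−R` is `−det R` on `ℝ³` (odd dimension). [folklore] -/
theorem det_neg_mul_linearIsometryEquiv (R : EuclideanSpace ℝ (Fin 3) ≃ₗᵢ[ℝ] EuclideanSpace ℝ (Fin 3)) :
    LinearMap.det (((LinearIsometryEquiv.neg ℝ) * R).toLinearEquiv :
        EuclideanSpace ℝ (Fin 3) →ₗ[ℝ] EuclideanSpace ℝ (Fin 3))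
      = -LinearMap.det (R.toLinearEquiv : EuclideanSpace ℝ (Fin 3) →ₗ[ℝ] EuclideanSpace ℝ (Fin 3)) := by
  rw [det_mul_linearIsometryEquiv]
  have h : ((LinearIsometryEquiv.neg ℝ : EuclideanSpace ℝ (Fin 3) ≃ₗᵢ[ℝ] EuclideanSpace ℝ (Fin 3)).toLinearEquiv :
      EuclideanSpace ℝ (Fin 3) →ₗ[ℝ] EuclideanSpace ℝ (Fin 3)) = (-1 : ℝ) • LinearMap.id := by
    ext y; simp
  rw [h, LinearMap.det_smul, LinearMap.det_id, finrank_euclideanSpace, Fintype.card_fin]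
  norm_num

/-- The determinant of a product of reflections in planes through the origin (all normal
vectors nonzero) is `(−1)^length`. [folklore] -/
theorem det_prod_reflections (l : List (EuclideanSpace ℝ (Fin 3))) (hl : ∀ v ∈ l, v ≠ 0) :
    LinearMap.det (((l.map fun v => (ℝ ∙ v)ᗮ.reflection).prod).toLinearEquiv :
      EuclideanSpace ℝ (Fin 3) →ₗ[ℝ] EuclideanSpace ℝ (Fin 3)) = (-1) ^ l.length := by
  induction l with
  | nil =>
    simp only [List.map_nil, List.prod_nil, List.length_nil, pow_zero]
    exact LinearMap.det_id
  | cons a t ih =>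
    rw [List.map_cons, List.prod_cons, det_mul_linearIsometryEquiv,
      det_reflection_orthogonal (hl a (by simp)), ih fun v hv => hl v (by simp [hv]),
      List.length_cons, pow_succ]
    ring

/-- Removing the zero vectors from a list does not change the product of the attached
reflections (the reflection attached to `0` is the identity). [folklore] -/
theorem prod_reflections_filter_ne_zero (l : List (EuclideanSpace ℝ (Fin 3))) :
    ((l.filter fun v => v ≠ 0).map fun v => (ℝ ∙ v)ᗮ.reflection).prod
      = (l.map fun v => (ℝ ∙ v)ᗮ.reflection).prod := by
  induction l with
  | nil => simp
  | cons a t ih =>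
    by_cases ha : a = 0
    · subst ha
      rw [List.filter_cons_of_neg (by simp), ih, List.map_cons, List.prod_cons]
      have h1 : ((ℝ ∙ (0 : EuclideanSpace ℝ (Fin 3)))ᗮ.reflection :
          EuclideanSpace ℝ (Fin 3) ≃ₗᵢ[ℝ] EuclideanSpace ℝ (Fin 3)) = 1 :=
        LinearIsometryEquiv.ext reflection_orthogonal_zero
      rw [h1, one_mul]
    · rw [List.filter_cons_of_pos (by simpa using ha), List.map_cons, List.map_cons, List.prod_cons,
        List.prod_cons, ih]

/-! ### From pairs of reflections and parity to `O(3)` -/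

variable {n : ℕ}

/-- **Two-reflection invariance plus parity gives `O(3)` invariance.** Let `T : (ℝ³)ⁿ → ℝ` be
invariant under the diagonal action of all products of two reflections `ρ_u ρ_{u'}`
(`u, u'` unit vectors) and under parity. Then `T (R ∘ x) = T x` for every linear isometry `R`
of `ℝ³`. Proof: Cartan–Dieudonné for `R` and for `−R`, a determinant count showing that one of
the two reflection products has even length, and pairing. [folklore] -/
theorem apply_linearIsometryEquiv_eq {T : (Fin n → EuclideanSpace ℝ (Fin 3)) → ℝ}
    (h2 : ∀ u u' : EuclideanSpace ℝ (Fin 3), ‖u‖ = 1 → ‖u'‖ = 1 →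
      ∀ x : Fin n → EuclideanSpace ℝ (Fin 3),
        T (fun i => (x i - (2 * ⟪x i, u'⟫) • u') - (2 * ⟪x i - (2 * ⟪x i, u'⟫) • u', u⟫) • u) = T x)
    (hpar : ∀ x : Fin n → EuclideanSpace ℝ (Fin 3), T (fun i => -(x i)) = T x)
    (R : EuclideanSpace ℝ (Fin 3) ≃ₗᵢ[ℝ] EuclideanSpace ℝ (Fin 3))
    (x : Fin n → EuclideanSpace ℝ (Fin 3)) : T (fun i => R (x i)) = T x := by
  -- invariance predicate and its closure properties
  let P : (EuclideanSpace ℝ (Fin 3) ≃ₗᵢ[ℝ] EuclideanSpace ℝ (Fin 3)) → Prop :=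
    fun A => ∀ x : Fin n → EuclideanSpace ℝ (Fin 3), T (fun i => A (x i)) = T x
  have hP1 : P 1 := fun x => rfl
  have hPmul : ∀ A B, P A → P B → P (A * B) := fun A B hA hB x => by
    have := hA (fun i => B (x i))
    exact this.trans (hB x)
  have hPneg : P (LinearIsometryEquiv.neg ℝ) := fun x => by simpa using hpar x
  have hPpair : ∀ a b : EuclideanSpace ℝ (Fin 3), a ≠ 0 → b ≠ 0 →
      P ((ℝ ∙ a)ᗮ.reflection * (ℝ ∙ b)ᗮ.reflection) := by
    intro a b ha hb x
    have key := h2 (‖a‖⁻¹ • a) (‖b‖⁻¹ • b) (norm_inv_norm_smul ha) (norm_inv_norm_smul hb) x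
    have hfun : (fun i => ((ℝ ∙ a)ᗮ.reflection * (ℝ ∙ b)ᗮ.reflection) (x i))
        = fun i => (x i - (2 * ⟪x i, ‖b‖⁻¹ • b⟫) • (‖b‖⁻¹ • b))
          - (2 * ⟪x i - (2 * ⟪x i, ‖b‖⁻¹ • b⟫) • (‖b‖⁻¹ • b), ‖a‖⁻¹ • a⟫) • (‖a‖⁻¹ • a) := by
      funext i
      rw [LinearIsometryEquiv.mul_def, LinearIsometryEquiv.trans_apply,
        reflection_orthogonal_apply_eq hb, reflection_orthogonal_apply_eq ha]
    rw [hfun]; exact key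
  -- even products of reflections (nonzero normals) are invariant; odd ones after one more
  have hlist : ∀ l : List (EuclideanSpace ℝ (Fin 3)), (∀ v ∈ l, v ≠ 0) →
      (Even l.length → P (l.map fun v => (ℝ ∙ v)ᗮ.reflection).prod) ∧
      (Odd l.length → ∀ c : EuclideanSpace ℝ (Fin 3), c ≠ 0 →
        P ((ℝ ∙ c)ᗮ.reflection * (l.map fun v => (ℝ ∙ v)ᗮ.reflection).prod)) := by
    intro l
    induction l with
    | nil => intro _; exact ⟨fun _ => by simpa using hP1, fun h => by simp at h⟩
    | cons a t ih =>
      intro hl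
      have ha : a ≠ 0 := hl a (by simp)
      obtain ⟨ihE, ihO⟩ := ih fun v hv => hl v (by simp [hv])
      refine ⟨fun hE => ?_, fun hO c hc => ?_⟩
      · rw [List.length_cons, Nat.even_add_one, Nat.not_even_iff_odd] at hE
        rw [List.map_cons, List.prod_cons]
        exact ihO hE a ha
      · rw [List.length_cons, Nat.odd_add_one, Nat.not_odd_iff_even] at hO
        rw [List.map_cons, List.prod_cons, ← mul_assoc]
        exact hPmul _ _ (hPpair c a hc ha) (ihE hO)
  -- Cartan–Dieudonné for `R`
  obtain ⟨l, -, hl⟩ := R.reflections_generate_dim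
  set l' := l.filter fun v => v ≠ 0 with hl'
  have hl'ne : ∀ v ∈ l', v ≠ 0 := fun v hv => by simpa [hl'] using (List.mem_filter.1 hv).2
  have hRl' : R = (l'.map fun v => (ℝ ∙ v)ᗮ.reflection).prod := by
    rw [hl', prod_reflections_filter_ne_zero, ← hl]
  rcases Nat.even_or_odd l'.length with hE | hO
  · have := (hlist l' hl'ne).1 hE
    rw [← hRl'] at this
    exact this x
  · -- `−R` is an even product
    set R' := (LinearIsometryEquiv.neg ℝ) * R with hR'
    obtain ⟨m, -, hm⟩ := R'.reflections_generate_dim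
    set m' := m.filter fun v => v ≠ 0 with hm'
    have hm'ne : ∀ v ∈ m', v ≠ 0 := fun v hv => by simpa [hm'] using (List.mem_filter.1 hv).2
    have hR'm' : R' = (m'.map fun v => (ℝ ∙ v)ᗮ.reflection).prod := by
      rw [hm', prod_reflections_filter_ne_zero, ← hm]
    have hdetR : LinearMap.det (R.toLinearEquiv : EuclideanSpace ℝ (Fin 3) →ₗ[ℝ] _) = -1 := by
      rw [hRl', det_prod_reflections l' hl'ne, hO.neg_one_pow]
    have hdetR' : LinearMap.det (R'.toLinearEquiv : EuclideanSpace ℝ (Fin 3) →ₗ[ℝ] _) = 1 := by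
      rw [hR', det_neg_mul_linearIsometryEquiv, hdetR, neg_neg]
    have hmE : Even m'.length := by
      by_contra hodd
      rw [Nat.not_even_iff_odd] at hodd
      rw [hR'm', det_prod_reflections m' hm'ne, hodd.neg_one_pow] at hdetR'
      norm_num at hdetR'
    have hPR' : P R' := by
      have := (hlist m' hm'ne).1 hmE
      rwa [← hR'm'] at this
    have hRR : R = (LinearIsometryEquiv.neg ℝ) * R' := by
      rw [hR', ← mul_assoc]
      have : (LinearIsometryEquiv.neg ℝ : EuclideanSpace ℝ (Fin 3) ≃ₗᵢ[ℝ] _) * LinearIsometryEquiv.neg ℝ = 1 := by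
        ext y; simp [LinearIsometryEquiv.mul_def]
      rw [this, one_mul]
    have := hPmul _ _ hPneg hPR'
    rw [← hRR] at this
    exact this x

end Summit.CriticalPhenomena.Ising3DConformalLimit.WardToMoebius
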